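import Summits.KontsevichZagierPeriods.Zeta5Search.DescentJ3RhinViola
import Summits.KontsevichZagierPeriods.Zeta5Search.VWPOfPosConsequences
import Summits.KontsevichZagierPeriods.Zeta5Search.SymRayWedgeDictionary
import Literature.NumberTheory.Irrationality.RhinViola2001.Theorem21Proofs
import Literature.NumberTheory.Transcendental.AperyIrrationality
import HarnessLib

/-!
# Brown–Zudilin's `P̂_n` on the diagonal: the descent (22) makes `2P̂_n` an integer combination of the rational parts
of Rhin–Viola integrals with denominators `d_κ²d_n` (cell `pub-zeta5`, seat ct-1 g46)

HONEST FRAMING: systematic search; no irrationality claim unless certified.  Bookkeeping of the `ζ(3)`-companion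
`P̂_n` of the totally symmetric cellular family (Brown–Zudilin 2022, Sect. 2; `= p̃_n/((−1)^{n+1}C(2n,n))`, Zudilin 2002
(15)); nothing here concerns the arithmetic nature of `ζ(5)` or `ζ(3)`; records in print UNMOVED; nothing is discharged.
Theorems only (0 `def`).

OUR work (Summit side).  On the diagonal `a = n·1⁸` (dual data `b = (3n;n⁷)`, `p = (n,n,n,2n,n,n,n)`, `q = (n,n,n,n,n)`,
`ρ_n = (−1)ⁿn!¹⁰/(4(2n)!)`, `d = 2n`) all nine hypotheses of the tree's UNCONDITIONAL form of Brown–Zudilin's descent (22)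
(`VWPOfPosConsequences.rhs22_eq_on_box`, partner `j = 1`) hold for every `n ≥ 1` (`converges_aDiag`, …), and the wedge
dictionary on the ray (`SymRayZudilin15.bz_Phat_ray`, `SymRayWedgeDictionary.QOf_diag/rhoOf_diag`) identifies its right-hand side:

* **`rhs22_aDiag`** — `Σ_{κ=n}^{2n} w_κ·J₃(n,n,n,2n−κ; n,n,κ) = 2Q_nζ(3) − 2P̂_n` (`n ≥ 1`), `Q_n`, `P̂_n` = Brown–Zudilin's
  `TotallySymmetric.Q / Phat` (the recursion solutions of Sect. 2), `w_κ = (−1)^{3n+κ}C(κ,n)C(n,κ−n)²`;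
* `rhs22_aDiag_sum` — the left-hand side written out (`rhs22` at `(p;q)(n·1⁸)`);
* **`J3_aDiag_rhinViola`** — each companion integral is Rhin–Viola's `I(n, 2n−κ, n, n, κ, κ, κ, n)` (`DescentJ3RhinViola.J3_eq_rhinViolaI`),
  whose integers (2.8) are `(κ, n, κ, n, n, n, n, n)`; hence RHIN–VIOLA'S THEOREM 2.1 in counting form
  (`RhinViola2001.Theorem21.theorem21_of_dom`, `M = N = κ`, `Q = n`): **`J₃,κ = a_κ + 2b_κζ(3)` with `b_κ ∈ ℤ` and
  `d_κ²·d_n·a_κ ∈ ℤ`** (`J3_aDiag_split`);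
* **`two_mul_Phat_eq_neg_sum`** — ζ(3) ∉ ℚ (Apéry; `Apery.irrational_zeta_three`) separates the rational parts:
  `2P̂_n = −Σ_κ w_κ a_κ` with such `a_κ` (`n ≥ 1`).
The denominators `2d_n²d_{2n}P̂_n ∈ ℤ` follow in `SymmetricPhatDenominators` (Kummer: `d_κ ∣ d_nC(κ,n)`).
-/

noncomputable section

open Finset MeasureTheory

namespace Summit.KontsevichZagierPeriods.Zeta5Search.SymmetricPhatDescent

open Literature.NumberTheory.Irrationality
open Literature.NumberTheory.Irrationality.BrownZudilin2022 (J3 w22 rhs22 pOf qOf QOf bOfA Converges convergenceForms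
  zchoose)
open Literature.NumberTheory.Irrationality.RhinViola2001 (Params I d)
open Literature.NumberTheory.Irrationality.RhinViola2001.Theorem21 (Dom theorem21_of_dom)
open Literature.NumberTheory.Transcendental (zetaValue)
open Summit.KontsevichZagierPeriods.Zeta5Search.WedgeDictionary (rhoOf coeffU coeffV dOf)
open Summit.KontsevichZagierPeriods.Zeta5Search.SymRay (aDiag bRay bRay' bOfA_diag update_bOfA_diag pOf_diag qOf_diag
  QOf_diag rhoOf_diag bz_Phat_ray dOf_bRay)
open Summit.KontsevichZagierPeriods.Zeta5Search.DescentJ3RhinViola (J3_eq_rhinViolaI)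

/-! ### The diagonal lies in the box of `rhs22_eq_on_box` -/

/-- The totally symmetric integral converges (all seventeen forms (3) equal `n`). -/
theorem converges_aDiag (n : ℕ) : Converges (aDiag n) := by
  intro x hx
  simp only [convergenceForms, aDiag, List.mem_cons, List.not_mem_nil, or_false] at hx
  omega

/-- `b_i(n·1⁸) = n` for `1 ≤ i ≤ 7` and `b₀ = 3n`. -/
theorem bRay_pos (n : ℕ) {i : ℕ} (h1 : 1 ≤ i) (h7 : i ≤ 7) : bRay n i = n := by
  simp [bRay, show i ≠ 0 by omega, h7]

/-- `p(n·1⁸) ≥ 0`. -/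
theorem pOf_aDiag_nonneg (n : ℕ) : ∀ i, 0 ≤ pOf (aDiag n) i := by
  intro i
  rw [pOf_diag]
  fin_cases i <;> simp

/-- **Brown–Zudilin's (22) on the diagonal, closed form**: for `n ≥ 1`,
`rhs22((p;q)(n·1⁸)) = 2Q_nζ(3) − 2P̂_n` with Brown–Zudilin's `Q_n` and `P̂_n`. -/
theorem rhs22_aDiag (n : ℕ) (hn : 1 ≤ n) :
    rhs22 (pOf (aDiag n)) (qOf (aDiag n)) =
      2 * (BrownZudilin2022.Q n : ℝ) * zetaValue 3 - 2 * ((BrownZudilin2022.Phat n : ℚ) : ℝ) := by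
  have h := VWPOfPosConsequences.rhs22_eq_on_box (aDiag n) 1 (by simp) (converges_aDiag n)
    (fun i hi => by
      rw [mem_Icc] at hi
      rw [bOfA_diag, bRay_pos n (i := i) hi.1 hi.2, SymRay.bRay_zero]; constructor <;> omega)
    (by rw [bOfA_diag, dOf_bRay]; omega)
    (by rw [bOfA_diag, bRay_pos n (i := 1) le_rfl (by norm_num), SymRay.bRay_zero]; omega)
    (fun i hi => by
      rw [mem_Icc] at hi
      rw [bOfA_diag, bRay_pos n (i := i) hi.1 hi.2, SymRay.bRay_zero]; omega)
    (pOf_aDiag_nonneg n)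
    (by
      have h4 : pOf (aDiag n) 4 = n := by rw [pOf_diag]; rfl
      have h3 : pOf (aDiag n) 3 = 2 * n := by rw [pOf_diag]; rfl
      have h3' : qOf (aDiag n) 3 = n := by rw [qOf_diag]; rfl
      rw [h4, h3, h3']; omega)
    (by
      rw [bOfA_diag, dOf_bRay, bRay_pos n (i := 1) le_rfl (by norm_num), bRay_pos n (i := 2) (by norm_num) (by norm_num),
        bRay_pos n (i := 7) (by norm_num) le_rfl, SymRay.bRay_zero]
      simp only [sub_self, max_self, add_zero]; omega)
  rw [h, update_bOfA_diag, bOfA_diag, rhoOf_diag, QOf_diag, ← bz_Phat_ray]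
  push_cast
  ring

/-- The left-hand side of (22) on the diagonal, written out: the binomial support is `n ≤ κ ≤ 2n` and the `κ`-th companion
integral is `J₃(n,n,n,2n−κ; n,n,κ)`. -/
theorem rhs22_aDiag_sum (n : ℕ) :
    rhs22 (pOf (aDiag n)) (qOf (aDiag n)) =
      ∑ κ ∈ Icc (n : ℤ) (n + n), (w22 (pOf (aDiag n)) (qOf (aDiag n)) κ : ℝ) * J3 n n n (2 * n - κ) n n (n - n + κ) := by
  unfold rhs22
  rw [pOf_diag, qOf_diag]
  simp

/-- The weight of (22) on the diagonal: `w_κ = (−1)^{3n+κ}·C(κ,n)·C(n,κ−n)²` in the integer-binomial convention `zchoose`. -/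
theorem w22_aDiag (n : ℕ) (κ : ℤ) :
    w22 (pOf (aDiag n)) (qOf (aDiag n)) κ =
      (-1) ^ (3 * (n : ℤ) + κ).toNat * zchoose κ n * zchoose n (κ - n) * zchoose n (κ - n) := by
  unfold w22
  rw [pOf_diag, qOf_diag]
  simp only [Matrix.cons_val]
  ring_nf

/-! ### The companion integrals are Rhin–Viola integrals with integers (2.8) `(κ,n,κ,n,n,n,n,n)` -/

/-- `J₃(n,n,n,2n−κ; n,n,κ) = I(n, 2n−κ, n, n, κ, κ, κ, n)`. -/
theorem J3_aDiag_rhinViola (n : ℕ) (κ : ℤ) :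
    J3 n n n (2 * n - κ) n n (n - n + κ) = I ⟨n, 2 * n - κ, n, n, κ, κ, κ, n⟩ := by
  rw [J3_eq_rhinViolaI]
  congr 1
  ext <;> simp

/-- Rhin–Viola's THEOREM 2.1 for the companion integral: for `n ≤ κ ≤ 2n`,
`J₃(n,n,n,2n−κ; n,n,κ) = a + 2bζ(3)` with `b ∈ ℤ` and `d_κ²·d_n·a ∈ ℤ` (`M = N = κ`, `Q = n` dominate `(κ,n,κ,n,n,n,n,n)`). -/
theorem J3_aDiag_split (n : ℕ) (κ : ℤ) (h1 : (n : ℤ) ≤ κ) (h2 : κ ≤ 2 * n) :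
    ∃ (a : ℚ) (b : ℤ), J3 n n n (2 * n - κ) n n (n - n + κ) = a + 2 * b * zetaValue 3 ∧
      ∃ A : ℤ, ((Nat.lcmUpto κ.toNat ^ 2 * Nat.lcmUpto n : ℕ) : ℚ) * a = A := by
  rw [J3_aDiag_rhinViola]
  have hN : (⟨n, 2 * n - κ, n, n, κ, κ, κ, n⟩ : Params).Nonneg := by
    refine ⟨?_, ?_, ?_, ?_, ?_, ?_, ?_, ?_⟩ <;> dsimp only <;> omega
  have hB : (⟨n, 2 * n - κ, n, n, κ, κ, κ, n⟩ : Params).Balanced :=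
    ⟨by show (n : ℤ) + κ = n + κ; rfl, by show 2 * (n : ℤ) - κ + κ = n + n; ring⟩
  have hS : (⟨n, 2 * n - κ, n, n, κ, κ, κ, n⟩ : Params).S = [κ, n, κ, n, n, n, n, n] := by
    simp only [Params.S, Params.aux, Params.toList]
    refine List.cons_eq_cons.2 ⟨by ring, List.cons_eq_cons.2 ⟨by ring, List.cons_eq_cons.2 ⟨by ring,
      List.cons_eq_cons.2 ⟨by ring, List.cons_eq_cons.2 ⟨by ring, List.cons_eq_cons.2 ⟨by ring,
      List.cons_eq_cons.2 ⟨by ring, List.cons_eq_cons.2 ⟨by ring, rfl⟩⟩⟩⟩⟩⟩⟩⟩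
  have hD : Dom (⟨n, 2 * n - κ, n, n, κ, κ, κ, n⟩ : Params).S κ κ n := by
    rw [hS]
    have hkk : ¬ κ < κ := lt_irrefl _
    have hkn : ¬ κ < n := not_lt.2 h1
    have hnn : ¬ (n : ℤ) < n := lt_irrefl _
    refine ⟨?_, ?_, ?_⟩ <;>
      simp only [List.countP_cons, List.countP_nil, hkk, hkn, hnn, decide_false, Bool.false_eq_true, ite_false,
        add_zero, zero_add] <;>
      first | omega | (split_ifs <;> omega)
  obtain ⟨a, b, hI, A, hA⟩ := theorem21_of_dom _ hN hB hD
  refine ⟨a, b, hI, A, ?_⟩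
  rw [← hA]
  simp only [d, Int.toNat_natCast]
  push_cast
  ring

/-! ### Apéry splits the rational parts -/

/-- `ℚ`-linear independence of `1, ζ(3)` (Apéry): `x + yζ(3) = x′ + y′ζ(3)` with rational `x, y, x′, y′` forces `x = x′`. -/
theorem rat_part_unique {x y x' y' : ℚ} (h : (x : ℝ) + y * zetaValue 3 = x' + y' * zetaValue 3) : x = x' := by
  by_contra hx
  have hy : (y : ℝ) ≠ y' := by
    intro hyy
    apply hx
    rw [hyy] at h
    have : (x : ℝ) = x' := by linarith
    exact_mod_cast this
  have hy' : ((y - y' : ℚ) : ℝ) ≠ 0 := by push_cast; exact sub_ne_zero.2 hy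
  apply Literature.NumberTheory.Transcendental.Apery.irrational_zeta_three
  refine ⟨(x' - x) / (y - y'), ?_⟩
  push_cast
  rw [div_eq_iff (by push_cast at hy'; exact hy')]
  linarith

/-- **`2P̂_n` is minus the weighted sum of the Rhin–Viola rational parts**: for `n ≥ 1` there are rationals `a_κ`
(`n ≤ κ ≤ 2n`) with `d_κ²·d_n·a_κ ∈ ℤ` and `2P̂_n = −Σ_{κ=n}^{2n} w_κ a_κ`. -/
theorem two_mul_Phat_eq_neg_sum (n : ℕ) (hn : 1 ≤ n) :
    ∃ a : ℤ → ℚ, (∀ κ ∈ Icc (n : ℤ) (n + n), ∃ A : ℤ, ((Nat.lcmUpto κ.toNat ^ 2 * Nat.lcmUpto n : ℕ) : ℚ) * a κ = A) ∧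
      2 * BrownZudilin2022.Phat n = -∑ κ ∈ Icc (n : ℤ) (n + n), (w22 (pOf (aDiag n)) (qOf (aDiag n)) κ : ℚ) * a κ := by
  -- choose the Rhin–Viola splitting term by term
  have hsplit : ∀ κ : ℤ, ∃ (a : ℚ) (b : ℤ), (κ ∈ Icc (n : ℤ) (n + n) →
      J3 n n n (2 * n - κ) n n (n - n + κ) = a + 2 * b * zetaValue 3 ∧
        ∃ A : ℤ, ((Nat.lcmUpto κ.toNat ^ 2 * Nat.lcmUpto n : ℕ) : ℚ) * a = A) := by
    intro κ
    by_cases hκ : κ ∈ Icc (n : ℤ) (n + n)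
    · rw [mem_Icc] at hκ
      obtain ⟨a, b, h⟩ := J3_aDiag_split n κ hκ.1 (by omega)
      exact ⟨a, b, fun _ => h⟩
    · exact ⟨0, 0, fun h => (hκ h).elim⟩
  choose a b hab using hsplit
  refine ⟨a, fun κ hκ => (hab κ hκ).2, ?_⟩
  -- the two evaluations of `rhs22` on the diagonal
  have hsum : rhs22 (pOf (aDiag n)) (qOf (aDiag n)) =
      ((∑ κ ∈ Icc (n : ℤ) (n + n), (w22 (pOf (aDiag n)) (qOf (aDiag n)) κ : ℚ) * a κ : ℚ) : ℝ) +
        ((2 * ∑ κ ∈ Icc (n : ℤ) (n + n), w22 (pOf (aDiag n)) (qOf (aDiag n)) κ * b κ : ℚ) : ℝ) * zetaValue 3 := by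
    rw [rhs22_aDiag_sum]
    push_cast
    simp only [mul_sum, sum_mul, ← sum_add_distrib]
    refine sum_congr rfl fun κ hκ => ?_
    rw [(hab κ hκ).1]
    ring
  have hclosed := rhs22_aDiag n hn
  rw [hsum] at hclosed
  have key := rat_part_unique (x := ∑ κ ∈ Icc (n : ℤ) (n + n), (w22 (pOf (aDiag n)) (qOf (aDiag n)) κ : ℚ) * a κ)
    (y := 2 * ∑ κ ∈ Icc (n : ℤ) (n + n), w22 (pOf (aDiag n)) (qOf (aDiag n)) κ * b κ)
    (x' := -(2 * BrownZudilin2022.Phat n)) (y' := 2 * (BrownZudilin2022.Q n : ℚ)) (by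
      rw [hclosed]; push_cast; ring)
  linarith

end Summit.KontsevichZagierPeriods.Zeta5Search.SymmetricPhatDescent
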